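import Summits.QuantumFields.YangMills.Theorems.BalabanUVNodesN15KingModelFullPropagatorRate
import Summits.QuantumFields.YangMills.Theorems.BalabanUVNodesN15KingModelPotential

/-!
# BalabanUVNodes ∕ N15 — THE KING MODEL, PART 10a: KING'S FULL `A = 0` FLUCTUATION PROPAGATOR IN THE ROW-UNIFORM RIEMANN-SUM NORM —
# uniform MASS `Σ_y N^{−(d+1)}|G^η_K(x, y)| ≤ C_M` and TWO-SPACING RATE `Σ_{y′} N′^{−(d+1)}|G^{η′}_{K+n}(x′, y′) − G^η_K(x, y)| ≤ C·(L^{−γ∕2})^K`,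
# uniform in `K`, `n`, the volume and the mass, WITH NO OFF-DIAGONAL RESTRICTION (Track A, DAG node N15 = NE2; FAN-OUT v1.1 §N15 s3)

HONEST FRAMING.  Count-neutral kernel bookkeeping (cell `pub-ymgap`, seat `pub-ymgap-dag-n15-d` g8; `--supports stmt-QuantumFields-20292
--as helper` = K3⁗ `SpineGivenEndpointR13Sep`; lineage K3 19676 → K3′ 19908 → K3‴ 19912).  TEMPLATE LITERATURE, `A = 0`: C. King's scalar
U(1)-Higgs MODEL on finite tori ([King1986] §2.2 p. 653 (2.13)–(2.17), p. 654 (2.20), Prop. 3.8 (3.71) p. 664, §4 p. 675 (4.42)–(4.44)),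
NOT Bałaban's covariant objects; NE2⁺ is NOT PRINTED for those and not proved here; NOT a node discharge; nothing continuum ∕ ℝ⁴ ∕ OS ∕
mass-gap ∕ Clay.  0 `sorry`, 0 `def`, standard axioms.
THE POINT.  Parts O-a ∕ O-b of the sibling seat (`…N15KingModelFullPropagator(Rate)`) proved the `K`-uniform decay and two-spacing η-rate of
King's full `A = 0` fluctuation propagator `G(K, M, m²) = King1986.Torus.constrainedProp (L^K) M (aK a L K) ((L^K)²) m²` POINTWISE, hence OFF
THE DIAGONAL only (`|B(x) − B(y)| ≥ D₀`; `G^η_K(x, x)` grows with `K`).  The dressed objects of this lineage (minimiser and effective Laplacian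
IN A POTENTIAL, parts 8d–9g, 10b) see `G` only through the RIEMANN SUMS `N^{−(d+1)}Σ_y G(x, y)f(y)` against bounded `f` (`A₀⁻¹ = N^{−(d+1)}·G`),
and in that ROW-UNIFORM RIEMANN-SUM NORM the diagonal is harmless: peeling (2.17) one level costs the prefactor `L^{d+1}∕L²` of King's (2.20)
(`fullProp_peel`) while the Riemann weight gains `L^{−(d+1)}`, net `L^{−2}` per level (a propagator has mass dimension `−2`).  THIS FILE runs the
two inductions of parts O-a ∕ O-b verbatim with `Σ_y N^{−(d+1)}|·|` in place of `|·|` and no `D₀`: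
* §1 `riemannSum_blocks`, **`riemannSum_exp_le`** (`N^{−(d+1)}Σ_x e^{−δ|b − B(x)|} ≤ K_{d+1}(δ)`, `tdistT_sumBound`), `riemannSum_le_of_decay`;
* §2 **`fullProp_riemannMass_unif`** — `∃ C_M`: ∀ `K ≥ 1` (any spelling `N = L^K`), cubes `2L^e`, `0 < m² ≤ m₀²`, `x`: `N^{−(d+1)}Σ_y|G^η_K(x, y)| ≤ C_M`
  (`M(K+1) ≤ L^{−2}(M(K) + C_SK(κ))` by the peel + part M `ksSlice_decay_unif`; base = [Ba 4] (1.10) with a point source, factor `L^{d+1}` a constant);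
* §3 **`fullProp_riemannRate_unif`** — `∃ C`: ∀ `K, n ≥ 1`, cubes, masses, `x′`: `N′^{−(d+1)}Σ_{y′}|G^{η′}_{K+n}(x′, y′) − G^η_K(x, y)| ≤ C·(L^{−γ∕2})^K`
  (`x, y` under `x′, y′`, King's pairing; `R(K+1) ≤ L^{−2}(R(K) + C_rK(κ)θ^K)` by `fullProp_peel_pair_abs_le` summed + part M `ksSlice_rate_unif`,
  closing because `L^{−2} ≤ L^{−1}θ`; base = two Riemann masses).
These are the inputs of part 10b (dressed minimiser: ℓ^∞ Neumann in the window `C_M·sup|w| ≤ 1∕2`, two-spacing sup rate), hence of the (3.36)∕(H3)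
rate of the FULL perturbation `Δ^{(k)}_v − Δ^{(k)}` (part 10c).
HONEST SCOPE.  (i) `A = 0`, periodic b.c., odd `L ≥ 3`, `0 < m² ≤ m₀²`, cubes `2L^e`; (ii) lattice units of the level-`K` lattice (parts F–O); (iii) `K, n ≥ 1`;
(iv) the Riemann-sum statements are NOT printed propositions of [King1986] ((3.71) is pointwise with the singular weight) — they are the
(2.17)-summed bookkeeping this lineage needs; (v) nothing here is Bałaban's `G_k(U)`; not a discharge.
Locators: [King1986] C. King, CMP **102** (1986) 649–677: (2.13)–(2.17) p. 653, (2.20) p. 654, Theorem 3.3 (3.7) p. 658, Prop. 3.7 (3.64) p. 663,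
Prop. 3.8 (3.71) p. 664 and p. 664 «When x′ ∈ T_{η′}, we denote by x that point in T_η for which x′ ∈ B^n(x)», (4.41) p. 675 (summation),
(4.42)–(4.44) p. 675; [Ba 4] = [Balaban1983RegularityDecay] Theorem (1.10) p. 573.
-/

noncomputable section

namespace Summit.QuantumFields.YangMills.BalabanUVNodes.N15.KingModel

open Real Finset Matrix
open Literature.MathematicalPhysics.QuantumFieldTheory.Balaban1983to89 (Params)
open Literature.MathematicalPhysics.QuantumFieldTheory.Balaban1983to89.B4Sect5Proof (latticeConst latticeConst_nonneg)
open Literature.MathematicalPhysics.QuantumFieldTheory.Balaban1983to89.B5Prop11Plancherel (Tor fine)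
open Literature.MathematicalPhysics.QuantumFieldTheory.King1986 (aK aK_pos)
open Literature.MathematicalPhysics.QuantumFieldTheory.King1986.Torus (constrainedProp flatten blockOf tdistT torCongr site
  blockOf_flatten blockOf_site tdistT_nonneg tdistT_sumBound constrainedProp_decay_blocks_unif)
open Summit.QuantumFields.YangMills.BalabanUVNodes.N15KingModelRung.Curved (KSliceIdx ksM ksU ksSlice ksSlice' underPtN
  blockOf_underPtN fullProp_peel_abs_le fullProp_peel_pair_abs_le underPtN_flatten fine_assoc ksSlice_decay_unif ksSlice_rate_unif)

variable {d : ℕ}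

/-! ## §1 Riemann sums on King's fine torus -/

section Riemann

variable (N : ℕ) [NeZero N] (U : Fin (d + 1) → ℕ) [∀ μ, NeZero (U μ)]

/-- **A block-constant function summed over the fine torus**: `Σ_{x ∈ Π ℤ∕(N·U_μ)} F(B(x)) = N^{d+1}·Σ_{z ∈ Π ℤ∕U_μ} F(z)` (every unit
block has `N^{d+1}` fine points). [cite: King1986, (2.4) p.652, (4.1)–(4.3) p.670] -/
theorem riemannSum_blocks (F : Tor U → ℝ) :
    ∑ x : Tor (fine N U), F (blockOf N U x) = ((N : ℕ) : ℝ) ^ (d + 1) * ∑ z, F z := by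
  rw [sum_fine_eq_sum_blocks N U (fun x => F (blockOf N U x)), mul_sum]
  refine sum_congr rfl fun z _ => ?_
  rw [sum_congr rfl fun j _ => by rw [blockOf_site], sum_const, card_univ, nsmul_eq_mul, card_offsets N]

/-- **THE RIEMANN SUM OF A BLOCK-DISTANCE EXPONENTIAL IS BOUNDED UNIFORMLY IN THE VOLUME AND THE SPACING**:
`N^{−(d+1)}·Σ_x e^{−δ·|b − B(x)|_U} ≤ K_{d+1}(δ)` (the tree's uniform torus sum `tdistT_sumBound` on the unit lattice, each block counted
`N^{d+1}` times with weight `N^{−(d+1)}`). [cite: King1986, (4.41) p.675] -/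
theorem riemannSum_exp_le {δ : ℝ} (hδ : 0 < δ) (b : Tor U) :
    (((N : ℕ) : ℝ) ^ (d + 1))⁻¹ * ∑ x : Tor (fine N U), Real.exp (-(δ * tdistT U b (blockOf N U x)))
      ≤ latticeConst (d + 1) δ := by
  have hN : ((N : ℕ) : ℝ) ^ (d + 1) ≠ 0 := pow_ne_zero _ (Nat.cast_ne_zero.mpr (NeZero.ne N))
  rw [riemannSum_blocks N U (fun z => Real.exp (-(δ * tdistT U b z))), ← mul_assoc, inv_mul_cancel₀ hN, one_mul]
  exact tdistT_sumBound U δ hδ b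

/-- The same with a kernel bound: if `|F(x)| ≤ c·e^{−δ|b − B(x)|}` pointwise then `N^{−(d+1)}·Σ_x |F(x)| ≤ c·K_{d+1}(δ)`. [cite: King1986, (4.41) p.675] -/
theorem riemannSum_le_of_decay {δ c : ℝ} (hδ : 0 < δ) (hc : 0 ≤ c) (b : Tor U) {F : Tor (fine N U) → ℝ}
    (hF : ∀ x, |F x| ≤ c * Real.exp (-(δ * tdistT U b (blockOf N U x)))) :
    (((N : ℕ) : ℝ) ^ (d + 1))⁻¹ * ∑ x : Tor (fine N U), |F x| ≤ c * latticeConst (d + 1) δ := by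
  have hNpos : (0 : ℝ) < ((N : ℕ) : ℝ) ^ (d + 1) := pow_pos (Nat.cast_pos.mpr (Nat.pos_of_ne_zero (NeZero.ne N))) _
  calc (((N : ℕ) : ℝ) ^ (d + 1))⁻¹ * ∑ x : Tor (fine N U), |F x|
      ≤ (((N : ℕ) : ℝ) ^ (d + 1))⁻¹ * ∑ x : Tor (fine N U), c * Real.exp (-(δ * tdistT U b (blockOf N U x))) :=
        mul_le_mul_of_nonneg_left (sum_le_sum fun x _ => hF x) (inv_nonneg.mpr hNpos.le)
    _ = c * ((((N : ℕ) : ℝ) ^ (d + 1))⁻¹ * ∑ x : Tor (fine N U), Real.exp (-(δ * tdistT U b (blockOf N U x)))) := by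
        rw [← mul_sum]; ring
    _ ≤ c * latticeConst (d + 1) δ := mul_le_mul_of_nonneg_left (riemannSum_exp_le N U hδ b) hc

end Riemann

/-! ## §2 The uniform Riemann mass of the full propagator -/

section Mass

variable (L : ℕ) [NeZero L]

/-- **THE ROW-UNIFORM RIEMANN MASS OF KING'S FULL `A = 0` FLUCTUATION PROPAGATOR IS BOUNDED UNIFORMLY IN THE NUMBER OF LEVELS**
(`G^η_K = King1986.Torus.constrainedProp (L^K) M (aK a L K) ((L^K)²) m² = (L^K)^{d+1}·A₀⁻¹`, so `N^{−(d+1)}Σ_y|G(x,y)|` is the ℓ^∞-operator norm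
of the row of `A₀⁻¹`): for odd `L ≥ 3`, `a > 0` and a mass cap `m₀² ≥ 0` there is `C_M > 0` (function of `d, L, a, m₀²`) such that for EVERY `K ≥ 1`
(any spelling `N = L^K`), every cube `M_μ = 2L^e`, every `0 < m² ≤ m₀²` and every fine `x`:  `N^{−(d+1)}·Σ_y |G^η_K(x, y)| ≤ C_M`.
Induction on `K` by part O-a's peel (the `L^{d+1}∕L²` of (2.20) against the `L^{−(d+1)}` of the Riemann weight: `M(K+1) ≤ L^{−2}(M(K) + C_SK(κ))`);
no off-diagonal restriction. [cite: King1986, (2.13)–(2.17) p.653, (2.20) p.654, Theorem 3.3 (3.7) p.658, (4.41)–(4.44) p.675; Balaban1983RegularityDecay, Theorem (1.10) p.573] -/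
theorem fullProp_riemannMass_unif (hLodd : Odd L) (hL : 2 ≤ L) {a : ℝ} (ha : 0 < a) {m0sq : ℝ} (hm0 : 0 ≤ m0sq) :
    ∃ C : ℝ, 0 < C ∧ ∀ (K : ℕ), 1 ≤ K → ∀ (N : ℕ) [NeZero N], N = L ^ K →
      ∀ (e : ℕ) (M : Fin (d + 1) → ℕ) [∀ μ, NeZero (M μ)], (∀ μ, M μ = 2 * L ^ e) →
      ∀ (msq : ℝ), 0 < msq → msq ≤ m0sq →
      ∀ x : Tor (fine N M),
        (((N : ℕ) : ℝ) ^ (d + 1))⁻¹ * ∑ y, |constrainedProp N M (aK a L K) (((N : ℕ) : ℝ) ^ 2) msq x y| ≤ C := by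
  have hL1 : 1 < L := by omega
  have hL0 : (0 : ℝ) < L := by exact_mod_cast (show 0 < L by omega)
  have hL2 : (4 : ℝ) ≤ (L : ℝ) ^ 2 := by
    have : (2 : ℝ) ≤ L := by exact_mod_cast hL
    nlinarith
  obtain ⟨δb, cb, hδb, hcb, Hb⟩ := constrainedProp_decay_blocks_unif (d + 1) L (by omega) ⟨hLodd, hL1⟩ ha hm0
  obtain ⟨Cs, κ, hCs, hκ, Hs⟩ := ksSlice_decay_unif (d := d) L hLodd hL ha hm0
  have hKb := latticeConst_nonneg (d + 1) hδb.le
  have hKκ := latticeConst_nonneg (d + 1) hκ.le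
  set B₀ : ℝ := (L : ℝ) ^ (d + 1) * cb * latticeConst (d + 1) δb with hB₀def
  have hB₀ : 0 ≤ B₀ := by positivity
  set C : ℝ := B₀ + Cs * latticeConst (d + 1) κ + 1 with hCdef
  have hC : 0 < C := by positivity
  refine ⟨C, hC, ?_⟩
  intro K hK
  induction K, hK using Nat.le_induction with
  | base =>
    intro N _ hN e M _ hM msq hmsq hcap x
    subst hN
    set P : Params := ⟨d + 1, L, e, 1, by omega, ⟨hLodd, hL1⟩⟩ with hPdef
    have hMK : ∀ μ, M μ = P.sitesPerDir P.K := fun μ => by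
      rw [hM μ]
      simp [hPdef, Params.sitesPerDir]
    have hpt : ∀ y, |constrainedProp (L ^ 1) M (aK a L 1) (((L ^ 1 : ℕ) : ℝ) ^ 2) msq x y|
        ≤ (L : ℝ) ^ (d + 1) * cb * Real.exp (-(δb * tdistT M (blockOf (L ^ 1) M x) (blockOf (L ^ 1) M y))) := by
      intro y
      have h := Hb P rfl rfl le_rfl msq hmsq.le hcap M hMK (L ^ 1) rfl x y
      have hcast : (((L ^ 1 : ℕ) : ℝ)) ^ P.d * cb = (L : ℝ) ^ (d + 1) * cb := by simp [hPdef]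
      rw [hcast] at h
      exact h
    calc (((L ^ 1 : ℕ) : ℝ) ^ (d + 1))⁻¹ * ∑ y, |constrainedProp (L ^ 1) M (aK a L 1) (((L ^ 1 : ℕ) : ℝ) ^ 2) msq x y|
        ≤ (L : ℝ) ^ (d + 1) * cb * latticeConst (d + 1) δb :=
          riemannSum_le_of_decay (L ^ 1) M hδb (by positivity) (blockOf (L ^ 1) M x) hpt
      _ ≤ C := by rw [hCdef]; linarith [mul_nonneg hCs.le hKκ]
  | succ K hK IH =>
    intro N _ hN e M _ hM msq hmsq hcap x'
    subst hN
    obtain rfl : M = fun _ => 2 * L ^ e := funext hM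
    set i : KSliceIdx d := ⟨e, K, hK, 1, le_rfl, 0, Nat.zero_le e, 1, le_rfl⟩ with hidef
    obtain ⟨x, rfl⟩ := (flatten (L ^ K) L (ksM L i)).surjective x'
    have hL2pos : (0 : ℝ) < (L : ℝ) ^ 2 := by positivity
    have hm2 : 0 < msq / (L : ℝ) ^ 2 := div_pos hmsq hL2pos
    have hm2cap : msq / (L : ℝ) ^ 2 ≤ m0sq := by
      have h1 : (1 : ℝ) ≤ (L : ℝ) ^ 2 := one_le_pow₀ (by exact_mod_cast (show 1 ≤ L by omega))
      exact (div_le_self hmsq.le h1).trans hcap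
    have hM' : ∀ μ, ksU L i μ = 2 * L ^ (e + 1) := fun μ => by
      show L * (2 * L ^ e) = 2 * L ^ (e + 1)
      ring
    have hIH : (((L ^ K : ℕ) : ℝ) ^ (d + 1))⁻¹ *
          ∑ y, |constrainedProp (L ^ K) (ksU L i) (aK a L K) (((L ^ K : ℕ) : ℝ) ^ 2) (msq / (L : ℝ) ^ 2) x y| ≤ C :=
      IH (L ^ K) rfl (e + 1) (ksU L i) hM' (msq / (L : ℝ) ^ 2) hm2 hm2cap x
    have hS : (((L ^ K : ℕ) : ℝ) ^ (d + 1))⁻¹ * ∑ y, |ksSlice L a (msq / (L : ℝ) ^ 2) i x y| ≤ Cs * latticeConst (d + 1) κ :=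
      riemannSum_le_of_decay (L ^ K) (ksU L i) hκ hCs.le (blockOf (L ^ K) (ksU L i) x)
        (fun y => (Hs (msq / (L : ℝ) ^ 2) hm2 hm2cap i).1 x y)
    have hNK : (0 : ℝ) < ((L ^ K : ℕ) : ℝ) ^ (d + 1) := by positivity
    have hcast : (((L ^ (K + 1) : ℕ) : ℝ)) ^ (d + 1) = (L : ℝ) ^ (d + 1) * ((L ^ K : ℕ) : ℝ) ^ (d + 1) := by
      push_cast; ring
    have hsum : ∑ y', |constrainedProp (L ^ (K + 1)) (fun _ : Fin (d + 1) => 2 * L ^ e) (aK a L (K + 1))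
          (((L ^ (K + 1) : ℕ) : ℝ) ^ 2) msq (flatten (L ^ K) L (ksM L i) x) y'|
        = ∑ y, |constrainedProp (L ^ K * L) (ksM L i) (aK a L (K + 1)) (((L ^ K * L : ℕ) : ℝ) ^ 2) msq
            (flatten (L ^ K) L (ksM L i) x) (flatten (L ^ K) L (ksM L i) y)| :=
      (Fintype.sum_equiv (flatten (L ^ K) L (ksM L i)) _ _ fun y => rfl).symm
    have hterm : ∀ y, |constrainedProp (L ^ K * L) (ksM L i) (aK a L (K + 1)) (((L ^ K * L : ℕ) : ℝ) ^ 2) msq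
          (flatten (L ^ K) L (ksM L i) x) (flatten (L ^ K) L (ksM L i) y)|
        ≤ (L : ℝ) ^ (d + 1) / (L : ℝ) ^ 2 *
          (|constrainedProp (L ^ K) (ksU L i) (aK a L K) (((L ^ K : ℕ) : ℝ) ^ 2) (msq / (L : ℝ) ^ 2) x y|
            + |ksSlice L a (msq / (L : ℝ) ^ 2) i x y|) := fun y => fullProp_peel_abs_le L hL ha hmsq i x y
    calc (((L ^ (K + 1) : ℕ) : ℝ) ^ (d + 1))⁻¹ * ∑ y', |constrainedProp (L ^ (K + 1)) (fun _ : Fin (d + 1) => 2 * L ^ e)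
            (aK a L (K + 1)) (((L ^ (K + 1) : ℕ) : ℝ) ^ 2) msq (flatten (L ^ K) L (ksM L i) x) y'|
        ≤ (((L ^ (K + 1) : ℕ) : ℝ) ^ (d + 1))⁻¹ * ∑ y, (L : ℝ) ^ (d + 1) / (L : ℝ) ^ 2 *
            (|constrainedProp (L ^ K) (ksU L i) (aK a L K) (((L ^ K : ℕ) : ℝ) ^ 2) (msq / (L : ℝ) ^ 2) x y|
              + |ksSlice L a (msq / (L : ℝ) ^ 2) i x y|) := by
          rw [hsum]
          exact mul_le_mul_of_nonneg_left (sum_le_sum fun y _ => hterm y) (by positivity)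
      _ = ((L : ℝ) ^ 2)⁻¹ *
            ((((L ^ K : ℕ) : ℝ) ^ (d + 1))⁻¹ *
                ∑ y, |constrainedProp (L ^ K) (ksU L i) (aK a L K) (((L ^ K : ℕ) : ℝ) ^ 2) (msq / (L : ℝ) ^ 2) x y|
              + (((L ^ K : ℕ) : ℝ) ^ (d + 1))⁻¹ * ∑ y, |ksSlice L a (msq / (L : ℝ) ^ 2) i x y|) := by
          rw [hcast, ← mul_sum, sum_add_distrib]
          field_simp
          ring
      _ ≤ ((L : ℝ) ^ 2)⁻¹ * (C + Cs * latticeConst (d + 1) κ) :=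
          mul_le_mul_of_nonneg_left (add_le_add hIH hS) (by positivity)
      _ ≤ C := by
          rw [inv_mul_le_iff₀ hL2pos, hCdef]
          nlinarith [mul_nonneg hCs.le hKκ, hB₀]

end Mass

/-! ## §3 The two-spacing rate of the full propagator in the Riemann-sum norm -/

section Rate

variable (L : ℕ) [NeZero L]

/-- **THE TWO-SPACING η-RATE OF KING'S FULL `A = 0` FLUCTUATION PROPAGATOR IN THE ROW-UNIFORM RIEMANN-SUM NORM, NO OFF-DIAGONAL
RESTRICTION**: for odd `L ≥ 3`, `a > 0`, a mass cap `m₀² ≥ 0` and `0 ≤ γ ≤ 1` there is `C > 0` (function of `d, L, a, m₀², γ`) such that for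
EVERY `K ≥ 1`, `n ≥ 1`, cube `M_μ = 2L^e`, mass `0 < m² ≤ m₀²` and every fine point `x′` of the `(K+n)`-level run:
`N′^{−(d+1)}·Σ_{y′} |G^{η′}_{K+n}(x′, y′) − G^η_K(x, y)| ≤ C·(L^{−γ∕2})^K` (`x, y` the points under `x′, y′`, King's pairing `underPtN`; both
propagators King's `constrainedProp` at the same mass in their level-`K` ∕ level-`(K+n)` lattice units).  Paired induction on `K` by part O-b's
`fullProp_peel_pair_abs_le` summed over the row: `R(K+1) ≤ L^{−2}(R(K) + C_rK(κ)θ^K)`, which closes because `L^{−2} ≤ L^{−1}θ`; base = two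
Riemann masses (§2).  This is the (2.17)-summed bookkeeping of Prop. 3.8 (3.71) line 1 in the norm the dressed minimiser consumes — not a printed
proposition. [cite: King1986, (2.13)–(2.17) p.653, (2.20) p.654, Prop. 3.8 (3.71) p.664, (4.41)–(4.43) p.675; Balaban1983RegularityDecay, Theorem (1.10) p.573] -/
theorem fullProp_riemannRate_unif (hLodd : Odd L) (hL : 2 ≤ L) {a : ℝ} (ha : 0 < a) {m0sq : ℝ} (hm0 : 0 ≤ m0sq) {γ : ℝ}
    (hγ0 : 0 ≤ γ) (hγ1 : γ ≤ 1) :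
    ∃ C : ℝ, 0 < C ∧ ∀ (K : ℕ), 1 ≤ K → ∀ (n : ℕ), 1 ≤ n →
      ∀ (e : ℕ) (M : Fin (d + 1) → ℕ) [∀ μ, NeZero (M μ)], (∀ μ, M μ = 2 * L ^ e) →
      ∀ (msq : ℝ), 0 < msq → msq ≤ m0sq →
      ∀ x' : Tor (fine (L ^ n * L ^ K) M),
        ((((L ^ n * L ^ K : ℕ) : ℝ)) ^ (d + 1))⁻¹ *
            ∑ y', |constrainedProp (L ^ n * L ^ K) M (aK a L (K + n)) (((L ^ n * L ^ K : ℕ) : ℝ) ^ 2) msq x' y'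
              - constrainedProp (L ^ K) M (aK a L K) (((L ^ K : ℕ) : ℝ) ^ 2) msq (underPtN L K n M x') (underPtN L K n M y')|
          ≤ C * ((L : ℝ) ^ (-(γ / 2))) ^ K := by
  have hL1 : 1 < L := by omega
  have hL1' : (1 : ℝ) ≤ L := by exact_mod_cast hL1.le
  have hL0 : (0 : ℝ) < L := by positivity
  set θ : ℝ := (L : ℝ) ^ (-(γ / 2)) with hθdef
  have hθ0 : 0 < θ := Real.rpow_pos_of_pos hL0 _
  have hθL : (L : ℝ)⁻¹ ≤ θ := by
    rw [hθdef, ← Real.rpow_neg_one]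
    exact Real.rpow_le_rpow_of_exponent_le hL1' (by linarith)
  obtain ⟨CM, hCM, HM⟩ := fullProp_riemannMass_unif (d := d) L hLodd hL ha hm0
  obtain ⟨δb, cb, hδb, hcb, Hb⟩ := constrainedProp_decay_blocks_unif (d + 1) L (by omega) ⟨hLodd, hL1⟩ ha hm0
  obtain ⟨Cr, κ, hCr, hκ, Hr⟩ := ksSlice_rate_unif (d := d) L hLodd hL ha hm0 hγ0 hγ1
  have hKb := latticeConst_nonneg (d + 1) hδb.le
  have hKκ := latticeConst_nonneg (d + 1) hκ.le
  set B₁ : ℝ := CM + (L : ℝ) ^ (d + 1) * cb * latticeConst (d + 1) δb with hB₁def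
  have hB₁ : 0 ≤ B₁ := by positivity
  set A : ℝ := B₁ * L + Cr * latticeConst (d + 1) κ + 1 with hAdef
  have hA : 0 < A := by positivity
  refine ⟨A, hA, ?_⟩
  intro K hK
  induction K, hK using Nat.le_induction with
  | base =>
    intro n hn e M _ hM msq hmsq hcap x'
    set u := underPtN L 1 n M x' with hu
    have hNpos : (0 : ℝ) < (((L ^ n * L ^ 1 : ℕ) : ℝ)) ^ (d + 1) := by positivity
    have hfine := HM (1 + n) (by omega) (L ^ n * L ^ 1) (by rw [pow_add, mul_comm]) e M hM msq hmsq hcap x'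
    set P : Params := ⟨d + 1, L, e, 1, by omega, ⟨hLodd, hL1⟩⟩ with hPdef
    have hMK : ∀ μ, M μ = P.sitesPerDir P.K := fun μ => by
      rw [hM μ]
      simp [hPdef, Params.sitesPerDir]
    have hpt : ∀ y' : Tor (fine (L ^ n * L ^ 1) M),
        |constrainedProp (L ^ 1) M (aK a L 1) (((L ^ 1 : ℕ) : ℝ) ^ 2) msq u (underPtN L 1 n M y')|
          ≤ (L : ℝ) ^ (d + 1) * cb * Real.exp (-(δb * tdistT M (blockOf (L ^ 1) M u) (blockOf (L ^ n * L ^ 1) M y'))) := by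
      intro y'
      have h := Hb P rfl rfl le_rfl msq hmsq.le hcap M hMK (L ^ 1) rfl u (underPtN L 1 n M y')
      have hcast : (((L ^ 1 : ℕ) : ℝ)) ^ P.d * cb = (L : ℝ) ^ (d + 1) * cb := by simp [hPdef]
      rw [hcast, blockOf_underPtN L 1 n M y'] at h
      exact h
    have hcoarse : ((((L ^ n * L ^ 1 : ℕ) : ℝ)) ^ (d + 1))⁻¹ *
          ∑ y', |constrainedProp (L ^ 1) M (aK a L 1) (((L ^ 1 : ℕ) : ℝ) ^ 2) msq u (underPtN L 1 n M y')|
        ≤ (L : ℝ) ^ (d + 1) * cb * latticeConst (d + 1) δb :=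
      riemannSum_le_of_decay (L ^ n * L ^ 1) M hδb (by positivity) (blockOf (L ^ 1) M u) hpt
    have hθ1 : B₁ ≤ A * θ ^ 1 := by
      rw [pow_one]
      calc B₁ = B₁ * L * (L : ℝ)⁻¹ := by field_simp
        _ ≤ A * θ := mul_le_mul (by rw [hAdef]; linarith [mul_nonneg hCr.le hKκ]) hθL (inv_pos.mpr hL0).le hA.le
    calc ((((L ^ n * L ^ 1 : ℕ) : ℝ)) ^ (d + 1))⁻¹ *
            ∑ y', |constrainedProp (L ^ n * L ^ 1) M (aK a L (1 + n)) (((L ^ n * L ^ 1 : ℕ) : ℝ) ^ 2) msq x' y'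
              - constrainedProp (L ^ 1) M (aK a L 1) (((L ^ 1 : ℕ) : ℝ) ^ 2) msq u (underPtN L 1 n M y')|
        ≤ ((((L ^ n * L ^ 1 : ℕ) : ℝ)) ^ (d + 1))⁻¹ *
            ∑ y', (|constrainedProp (L ^ n * L ^ 1) M (aK a L (1 + n)) (((L ^ n * L ^ 1 : ℕ) : ℝ) ^ 2) msq x' y'|
              + |constrainedProp (L ^ 1) M (aK a L 1) (((L ^ 1 : ℕ) : ℝ) ^ 2) msq u (underPtN L 1 n M y')|) :=
          mul_le_mul_of_nonneg_left (sum_le_sum fun y' _ => abs_sub _ _) (inv_nonneg.mpr hNpos.le)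
      _ = ((((L ^ n * L ^ 1 : ℕ) : ℝ)) ^ (d + 1))⁻¹ *
              ∑ y', |constrainedProp (L ^ n * L ^ 1) M (aK a L (1 + n)) (((L ^ n * L ^ 1 : ℕ) : ℝ) ^ 2) msq x' y'|
            + ((((L ^ n * L ^ 1 : ℕ) : ℝ)) ^ (d + 1))⁻¹ *
              ∑ y', |constrainedProp (L ^ 1) M (aK a L 1) (((L ^ 1 : ℕ) : ℝ) ^ 2) msq u (underPtN L 1 n M y')| := by
          rw [sum_add_distrib, mul_add]
      _ ≤ CM + (L : ℝ) ^ (d + 1) * cb * latticeConst (d + 1) δb := add_le_add hfine hcoarse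
      _ ≤ A * θ ^ 1 := hθ1
  | succ K hK IH =>
    intro n hn e M _ hM msq hmsq hcap x''
    obtain rfl : M = fun _ => 2 * L ^ e := funext hM
    set i : KSliceIdx d := ⟨e, K, hK, n, hn, 0, Nat.zero_le e, 1, le_rfl⟩ with hidef
    have h : ∀ μ, fine (L ^ n * L ^ K * L) (ksM L i) μ = fine (L ^ n * L ^ (K + 1)) (ksM L i) μ :=
      fine_assoc L K n (ksM L i)
    set E := (flatten (L ^ n * L ^ K) L (ksM L i)).trans (torCongr h) with hEdef
    obtain ⟨x', rfl⟩ := E.surjective x''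
    set x := underPtN L K n (ksU L i) x' with hxdef
    have hL2pos : (0 : ℝ) < (L : ℝ) ^ 2 := by positivity
    have hm2 : 0 < msq / (L : ℝ) ^ 2 := div_pos hmsq hL2pos
    have hm2cap : msq / (L : ℝ) ^ 2 ≤ m0sq := by
      have h1 : (1 : ℝ) ≤ (L : ℝ) ^ 2 := one_le_pow₀ hL1'
      exact (div_le_self hmsq.le h1).trans hcap
    have hM' : ∀ μ, ksU L i μ = 2 * L ^ (e + 1) := fun μ => by
      show L * (2 * L ^ e) = 2 * L ^ (e + 1)
      ring
    have hIH : ((((L ^ n * L ^ K : ℕ) : ℝ)) ^ (d + 1))⁻¹ *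
          ∑ y', |constrainedProp (L ^ n * L ^ K) (ksU L i) (aK a L (K + n)) (((L ^ n * L ^ K : ℕ) : ℝ) ^ 2)
              (msq / (L : ℝ) ^ 2) x' y'
            - constrainedProp (L ^ K) (ksU L i) (aK a L K) (((L ^ K : ℕ) : ℝ) ^ 2) (msq / (L : ℝ) ^ 2) x
              (underPtN L K n (ksU L i) y')|
        ≤ A * θ ^ K :=
      IH n hn (e + 1) (ksU L i) hM' (msq / (L : ℝ) ^ 2) hm2 hm2cap x'
    have hS : ((((L ^ n * L ^ K : ℕ) : ℝ)) ^ (d + 1))⁻¹ *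
          ∑ y', |ksSlice' L a (msq / (L : ℝ) ^ 2) i x' y' - ksSlice L a (msq / (L : ℝ) ^ 2) i x (underPtN L K n (ksU L i) y')|
        ≤ Cr * θ ^ K * latticeConst (d + 1) κ := by
      refine riemannSum_le_of_decay (L ^ n * L ^ K) (ksU L i) hκ (by positivity) (blockOf (L ^ K) (ksU L i) x) fun y' => ?_
      have h1 := Hr (msq / (L : ℝ) ^ 2) hm2 hm2cap i x' y'
      rw [blockOf_underPtN L K n (ksU L i) y'] at h1
      exact h1
    have hNK : (0 : ℝ) < (((L ^ n * L ^ K : ℕ) : ℝ)) ^ (d + 1) := by positivity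
    have hcast : (((L ^ n * L ^ (K + 1) : ℕ) : ℝ)) ^ (d + 1) = (L : ℝ) ^ (d + 1) * (((L ^ n * L ^ K : ℕ) : ℝ)) ^ (d + 1) := by
      push_cast; ring
    have hsum : ∑ y'', |constrainedProp (L ^ n * L ^ (K + 1)) (fun _ : Fin (d + 1) => 2 * L ^ e) (aK a L (K + 1 + n))
            (((L ^ n * L ^ (K + 1) : ℕ) : ℝ) ^ 2) msq (E x') y''
          - constrainedProp (L ^ (K + 1)) (fun _ : Fin (d + 1) => 2 * L ^ e) (aK a L (K + 1))
            (((L ^ (K + 1) : ℕ) : ℝ) ^ 2) msq (underPtN L (K + 1) n (fun _ => 2 * L ^ e) (E x'))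
            (underPtN L (K + 1) n (fun _ => 2 * L ^ e) y'')|
        = ∑ y', |constrainedProp (L ^ n * L ^ (K + 1)) (ksM L i) (aK a L (K + 1 + n))
            (((L ^ n * L ^ (K + 1) : ℕ) : ℝ) ^ 2) msq
            (torCongr h (flatten (L ^ n * L ^ K) L (ksM L i) x')) (torCongr h (flatten (L ^ n * L ^ K) L (ksM L i) y'))
          - constrainedProp (L ^ K * L) (ksM L i) (aK a L (K + 1)) (((L ^ K * L : ℕ) : ℝ) ^ 2) msq
            (flatten (L ^ K) L (ksM L i) x) (flatten (L ^ K) L (ksM L i) (underPtN L K n (ksU L i) y'))| := by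
      refine (Fintype.sum_equiv E _ _ fun y' => ?_).symm
      simp only [hEdef, Equiv.trans_apply]
      rw [underPtN_flatten L K n (ksM L i) h x', underPtN_flatten L K n (ksM L i) h y']
      rfl
    have hterm : ∀ y', |constrainedProp (L ^ n * L ^ (K + 1)) (ksM L i) (aK a L (K + 1 + n))
            (((L ^ n * L ^ (K + 1) : ℕ) : ℝ) ^ 2) msq
            (torCongr h (flatten (L ^ n * L ^ K) L (ksM L i) x')) (torCongr h (flatten (L ^ n * L ^ K) L (ksM L i) y'))
          - constrainedProp (L ^ K * L) (ksM L i) (aK a L (K + 1)) (((L ^ K * L : ℕ) : ℝ) ^ 2) msq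
            (flatten (L ^ K) L (ksM L i) x) (flatten (L ^ K) L (ksM L i) (underPtN L K n (ksU L i) y'))|
        ≤ (L : ℝ) ^ (d + 1) / (L : ℝ) ^ 2 *
          (|constrainedProp (L ^ n * L ^ K) (ksU L i) (aK a L (K + n)) (((L ^ n * L ^ K : ℕ) : ℝ) ^ 2)
                (msq / (L : ℝ) ^ 2) x' y'
              - constrainedProp (L ^ K) (ksU L i) (aK a L K) (((L ^ K : ℕ) : ℝ) ^ 2) (msq / (L : ℝ) ^ 2) x
                (underPtN L K n (ksU L i) y')|
            + |ksSlice' L a (msq / (L : ℝ) ^ 2) i x' y' - ksSlice L a (msq / (L : ℝ) ^ 2) i x (underPtN L K n (ksU L i) y')|) :=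
      fun y' => fullProp_peel_pair_abs_le L hL ha hmsq i x' y' x (underPtN L K n (ksU L i) y') h
    have hgain : ((L : ℝ) ^ 2)⁻¹ * (A * θ ^ K + Cr * θ ^ K * latticeConst (d + 1) κ) ≤ A * θ ^ (K + 1) := by
      have h1 : Cr * latticeConst (d + 1) κ ≤ A * ((L : ℝ) - 1) := by
        rw [hAdef]
        have : (1 : ℝ) ≤ (L : ℝ) - 1 := by
          have : (2 : ℝ) ≤ L := by exact_mod_cast hL
          linarith
        nlinarith [mul_nonneg hCr.le hKκ, mul_nonneg hB₁ hL0.le]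
      have h2 : ((L : ℝ) ^ 2)⁻¹ * (A + Cr * latticeConst (d + 1) κ) ≤ A * θ := by
        calc ((L : ℝ) ^ 2)⁻¹ * (A + Cr * latticeConst (d + 1) κ) ≤ ((L : ℝ) ^ 2)⁻¹ * (A * L) :=
              mul_le_mul_of_nonneg_left (by linarith) (by positivity)
          _ = A * (L : ℝ)⁻¹ := by field_simp
          _ ≤ A * θ := mul_le_mul_of_nonneg_left hθL hA.le
      calc ((L : ℝ) ^ 2)⁻¹ * (A * θ ^ K + Cr * θ ^ K * latticeConst (d + 1) κ)
          = ((L : ℝ) ^ 2)⁻¹ * (A + Cr * latticeConst (d + 1) κ) * θ ^ K := by ring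
        _ ≤ A * θ * θ ^ K := mul_le_mul_of_nonneg_right h2 (pow_nonneg hθ0.le K)
        _ = A * θ ^ (K + 1) := by rw [pow_succ]; ring
    calc ((((L ^ n * L ^ (K + 1) : ℕ) : ℝ)) ^ (d + 1))⁻¹ *
            ∑ y'', |constrainedProp (L ^ n * L ^ (K + 1)) (fun _ : Fin (d + 1) => 2 * L ^ e) (aK a L (K + 1 + n))
                (((L ^ n * L ^ (K + 1) : ℕ) : ℝ) ^ 2) msq (E x') y''
              - constrainedProp (L ^ (K + 1)) (fun _ : Fin (d + 1) => 2 * L ^ e) (aK a L (K + 1))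
                (((L ^ (K + 1) : ℕ) : ℝ) ^ 2) msq (underPtN L (K + 1) n (fun _ => 2 * L ^ e) (E x'))
                (underPtN L (K + 1) n (fun _ => 2 * L ^ e) y'')|
        ≤ ((((L ^ n * L ^ (K + 1) : ℕ) : ℝ)) ^ (d + 1))⁻¹ * ∑ y', (L : ℝ) ^ (d + 1) / (L : ℝ) ^ 2 *
            (|constrainedProp (L ^ n * L ^ K) (ksU L i) (aK a L (K + n)) (((L ^ n * L ^ K : ℕ) : ℝ) ^ 2)
                  (msq / (L : ℝ) ^ 2) x' y'
                - constrainedProp (L ^ K) (ksU L i) (aK a L K) (((L ^ K : ℕ) : ℝ) ^ 2) (msq / (L : ℝ) ^ 2) x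
                  (underPtN L K n (ksU L i) y')|
              + |ksSlice' L a (msq / (L : ℝ) ^ 2) i x' y'
                - ksSlice L a (msq / (L : ℝ) ^ 2) i x (underPtN L K n (ksU L i) y')|) := by
          rw [hsum]
          exact mul_le_mul_of_nonneg_left (sum_le_sum fun y' _ => hterm y') (by positivity)
      _ = ((L : ℝ) ^ 2)⁻¹ *
            (((((L ^ n * L ^ K : ℕ) : ℝ)) ^ (d + 1))⁻¹ *
                ∑ y', |constrainedProp (L ^ n * L ^ K) (ksU L i) (aK a L (K + n)) (((L ^ n * L ^ K : ℕ) : ℝ) ^ 2)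
                    (msq / (L : ℝ) ^ 2) x' y'
                  - constrainedProp (L ^ K) (ksU L i) (aK a L K) (((L ^ K : ℕ) : ℝ) ^ 2) (msq / (L : ℝ) ^ 2) x
                    (underPtN L K n (ksU L i) y')|
              + ((((L ^ n * L ^ K : ℕ) : ℝ)) ^ (d + 1))⁻¹ *
                ∑ y', |ksSlice' L a (msq / (L : ℝ) ^ 2) i x' y'
                  - ksSlice L a (msq / (L : ℝ) ^ 2) i x (underPtN L K n (ksU L i) y')|) := by
          rw [hcast, ← mul_sum, sum_add_distrib]
          field_simp
          ring
      _ ≤ ((L : ℝ) ^ 2)⁻¹ * (A * θ ^ K + Cr * θ ^ K * latticeConst (d + 1) κ) :=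
          mul_le_mul_of_nonneg_left (add_le_add hIH hS) (by positivity)
      _ ≤ A * θ ^ (K + 1) := hgain

end Rate

end Summit.QuantumFields.YangMills.BalabanUVNodes.N15.KingModel

end
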